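import Summits.CriticalPhenomena.PercolationContinuityZ3.Theorems.Transplant.Z3DiagonalNoConc
import HarnessLib

/-!
# The link of the hexagonal close packing — the TRIANGULAR ORTHOBICUPOLA graph `J₂₇` (12 vertices, 24 edges) — has exponent six:
# **every injective adjacency-preserving self-map `π` satisfies `π⁶ = id`** (so none of its vertices has a `π`-orbit of length divisible by 4)

builds on p205010 (kernel theorem, internal audit signed; external expert review pending) — nothing in this file uses p205010.
Status sentence (coordinator 2026-08-20T04:30Z): "θ(p_c) = 0 on ℤ^d, all d ≥ 2 — kernel-verified (Lean 4/Mathlib, standard axioms); internal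
adversarial audit SIGNED 2026-08-20 04:29Z; external expert review pending."
Lane `prim-bschramm-*`, seat `prim-bschramm-p2` (gen 9; PART C1b class map — the hcp row of `P2-LATTICES.md` §15/§21/§24); helper file
(`--supports stmt-CriticalPhenomena-4575 --as helper`).  Pure finite combinatorics; the consumer is `HcpNoConc` (the hcp contact graph carries no
`PlanarSkeletonConc`, for ANY skeleton map: the lifted quarter-turn would permute the 12 neighbours of a base vertex by an automorphism of this
link graph while turning the displacement of the step neighbour by `R`, `R⁶ = −1`).

THE GRAPH (`J`): hexagon `h₀ … h₅` (indices `0–5`, the six in-layer neighbours, a 6-cycle), top triangle `t₀ t₁ t₂` (`6–8`, the three neighbours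
in the layer above) and bottom triangle `b₀ b₁ b₂` (`9–11`), with `tᵢ` AND `bᵢ` both joined to the consecutive pair `h_{2i}, h_{2i+1}` (ORTHO: the
two triangles are aligned, as in the ABAB stacking; in the cuboctahedron = fcc link they are staggered and the automorphism group has order 48 ∋ 4).
THE PROOF: (1) the positive-existential property "some neighbour of `a` is adjacent to two other neighbours of `a`" holds exactly on the hexagon
(`P_iff`), so `π` maps the hexagon into itself, hence (pigeonhole) onto itself and the triangles into the triangles; (2) on the hexagon `π` is an
automorphism of the 6-cycle, `π⁶ = id` there by p5-g5's `Z3Diag.cyc_aut_pow_six`; (3) a triangle vertex and its image have H-neighbour pairs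
`{h_{2i}, h_{2i+1}} ↦ {π h_{2i}, π h_{2i+1}}`, so `tᵢ` and `bᵢ` (same pair) are mapped into a common pair `g i`, onto different members
(injectivity), and adjacent tops to a common side: `π (side, i) = (side ⊻ e, g i)` with `g` injective on `Fin 3`, whence `π⁶ = id` on the
triangles too (`g⁶ = id`, `e ⊻ e = 0`).
* `J`, `hx`, `tv`, `P`, `P_iff`, `aut_mapsto_H`, **`aut_pow_six`**.
[cite: ConwaySloane1999, Ch. 4 §6.1 (the hexagonal close packing; its contact polytope, the triangular orthobicupola)]
[cite: KozmaNitzan2024, §4 p. 16 (Lemma 8: the role of the lattice symmetries)]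
-/

namespace Summit.CriticalPhenomena.PercolationContinuityZ3.Theorems.Transplant

namespace J27

open Z3Diag (cyc cyc_aut_pow_six)

/-! ## §1 The graph -/

/-- The adjacency table of the triangular orthobicupola graph on `Fin 12` (Boolean, on the values). [cite: ConwaySloane1999, Ch. 4 §6.1] -/
def jb (a b : ℕ) : Bool :=
  -- hexagon 6-cycle
  (a < 6 && b < 6 && (b == (a + 1) % 6 || a == (b + 1) % 6)) ||
  -- top triangle, bottom triangle
  (6 ≤ a && a < 9 && 6 ≤ b && b < 9 && a != b) || (9 ≤ a && a < 12 && 9 ≤ b && b < 12 && a != b) ||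
  -- `tᵢ`, `bᵢ` joined to `h_{2i}`, `h_{2i+1}`
  (6 ≤ a && a < 12 && b < 6 && b / 2 == (a - 6) % 3) || (6 ≤ b && b < 12 && a < 6 && a / 2 == (b - 6) % 3)

/-- The table is symmetric. [folklore] -/
theorem jb_symm : ∀ a b : Fin 12, jb a b = jb b a := by decide

/-- The table is irreflexive. [folklore] -/
theorem jb_irrefl : ∀ a : Fin 12, jb a a = false := by decide

/-- **The triangular orthobicupola graph `J₂₇`** (the link of a vertex of the hexagonal close packing). [cite: ConwaySloane1999, Ch. 4 §6.1] -/
def J : SimpleGraph (Fin 12) := SimpleGraph.fromRel fun a b => jb a b = true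

/-- Adjacency in `J` is the table. [folklore] -/
theorem J_adj_iff (a b : Fin 12) : J.Adj a b ↔ jb a b = true := by
  rw [J, SimpleGraph.fromRel_adj]
  constructor
  · rintro ⟨hne, h | h⟩
    · exact h
    · rw [jb_symm]; exact h
  · intro h
    refine ⟨fun e => ?_, Or.inl h⟩
    subst e; rw [jb_irrefl] at h; exact Bool.false_ne_true h

/-- Adjacency in `J` is decidable (through the table). [folklore] -/
instance : DecidableRel J.Adj := fun a b => decidable_of_iff _ (J_adj_iff a b).symm

/-- The hexagon vertex `h_m`. [folklore] -/
def hx (m : Fin 6) : Fin 12 := ⟨m, by omega⟩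

/-- The triangle vertex: `tv true i = tᵢ` (top), `tv false i = bᵢ` (bottom). [folklore] -/
def tv (s : Bool) (i : Fin 3) : Fin 12 := if s then ⟨6 + i, by omega⟩ else ⟨9 + i, by omega⟩

/-- The side of a vertex (`true` = not a bottom vertex). [folklore] -/
def side (u : Fin 12) : Bool := decide (u.val < 9)

/-- The pair index of a triangle vertex. [folklore] -/
def pidx (u : Fin 12) : Fin 3 := ⟨(u.val - 6) % 3, Nat.mod_lt _ (by norm_num)⟩

/-- Every non-hexagon vertex is a triangle vertex `tv (side u) (pidx u)`. [folklore] -/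
theorem tv_side_pidx : ∀ u : Fin 12, 6 ≤ u.val → tv (side u) (pidx u) = u := by decide

/-- `side` and `pidx` of `tv`. [folklore] -/
theorem side_tv : ∀ (s : Bool) (i : Fin 3), side (tv s i) = s := by decide
/-- `side` and `pidx` of `tv`. [folklore] -/
theorem pidx_tv : ∀ (s : Bool) (i : Fin 3), pidx (tv s i) = i := by decide
/-- Triangle vertices are not hexagon vertices. [folklore] -/
theorem six_le_tv : ∀ (s : Bool) (i : Fin 3), 6 ≤ (tv s i).val := by decide
/-- Hexagon vertices have value `< 6`. [folklore] -/
theorem hx_lt (m : Fin 6) : (hx m).val < 6 := m.2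

/-- Top and bottom vertices differ. [folklore] -/
theorem tv_true_ne_false : ∀ i : Fin 3, tv true i ≠ tv false i := by decide

/-- Injective self-maps of `Fin 3` have sixth iterate the identity. [folklore] -/
theorem fin3_inj_pow_six : ∀ f : Fin 3 → Fin 3, Function.Injective f → ∀ i, f^[6] i = i := by decide

/-- The side map `s ↦ (s == e)` is an involution. [folklore] -/
theorem beq_beq : ∀ e s : Bool, ((s == e) == e) = s := by decide

/-- The map on the pair indices induced by `π` (through the top vertices). [folklore] -/
def g (π : Fin 12 → Fin 12) (i : Fin 3) : Fin 3 := pidx (π (tv true i))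

/-- **The hexagon is a 6-cycle.** [folklore] -/
theorem adj_hx_iff : ∀ m n : Fin 6, J.Adj (hx m) (hx n) ↔ cyc m n := by decide

/-- **Adjacency among triangle vertices: same side, different index.** [folklore] -/
theorem adj_tv_iff : ∀ (s s' : Bool) (i i' : Fin 3), J.Adj (tv s i) (tv s' i') ↔ (s = s' ∧ i ≠ i') := by decide

/-- **The hexagon neighbours of a triangle vertex are `h_{2i}, h_{2i+1}`.** [folklore] -/
theorem adj_tv_hx_iff : ∀ (s : Bool) (i : Fin 3) (m : Fin 6), J.Adj (tv s i) (hx m) ↔ (m.val = 2 * i.val ∨ m.val = 2 * i.val + 1) := by decide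

/-- The distinguishing property: some neighbour `b` of `a` is adjacent to two other neighbours `c ≠ d` of `a`. [folklore] -/
def P (a : Fin 12) : Prop := ∃ b c d : Fin 12, J.Adj a b ∧ J.Adj a c ∧ J.Adj a d ∧ c ≠ d ∧ J.Adj b c ∧ J.Adj b d

/-- Witnesses for `P` on the hexagon: the pair-mate `h_{m ± 1}`, and the pair's top and bottom vertices. [folklore] -/
def wb : Fin 12 → Fin 12 := ![1, 0, 3, 2, 5, 4, 0, 0, 0, 0, 0, 0]
/-- Witnesses for `P` on the hexagon. [folklore] -/
def wc : Fin 12 → Fin 12 := ![6, 6, 7, 7, 8, 8, 0, 0, 0, 0, 0, 0]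
/-- Witnesses for `P` on the hexagon. [folklore] -/
def wd : Fin 12 → Fin 12 := ![9, 9, 10, 10, 11, 11, 0, 0, 0, 0, 0, 0]

/-- The witnesses work. [folklore] -/
theorem witnesses_ok : ∀ a : Fin 12, a.val < 6 →
    J.Adj a (wb a) ∧ J.Adj a (wc a) ∧ J.Adj a (wd a) ∧ wc a ≠ wd a ∧ J.Adj (wb a) (wc a) ∧ J.Adj (wb a) (wd a) := by decide

/-- `P` holds on the hexagon. [folklore] -/
theorem P_of_lt_six (a : Fin 12) (ha : a.val < 6) : P a :=
  ⟨wb a, wc a, wd a, witnesses_ok a ha⟩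

/-- `P` fails on the triangles (the neighbourhood of `tᵢ` induces a perfect matching). [folklore] -/
theorem not_P_of_six_le : ∀ a : Fin 12, 6 ≤ a.val → ¬ P a := by
  unfold P
  decide

/-- **`P a ↔ a` is a hexagon vertex.** [folklore] -/
theorem P_iff (a : Fin 12) : P a ↔ a.val < 6 :=
  ⟨fun h => by by_contra h'; exact not_P_of_six_le a (by omega) h, P_of_lt_six a⟩

/-! ## §2 Automorphisms: the hexagon and the triangles are invariant -/

variable {π : Fin 12 → Fin 12} (hinj : Function.Injective π) (hadj : ∀ a b, J.Adj a b → J.Adj (π a) (π b))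
include hinj hadj

/-- `P` is positive-existential, hence preserved. [folklore] -/
theorem P_map {a : Fin 12} (h : P a) : P (π a) := by
  obtain ⟨b, c, d, hab, hac, had, hcd, hbc, hbd⟩ := h
  exact ⟨π b, π c, π d, hadj _ _ hab, hadj _ _ hac, hadj _ _ had, fun e => hcd (hinj e), hadj _ _ hbc, hadj _ _ hbd⟩

/-- **The hexagon is mapped into the hexagon …** [folklore] -/
theorem lt_six_map {a : Fin 12} (ha : a.val < 6) : (π a).val < 6 :=
  (P_iff _).1 (P_map hinj hadj ((P_iff a).2 ha))

/-- **… hence onto it, and the triangles into the triangles** (pigeonhole). [folklore] -/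
theorem six_le_map {a : Fin 12} (ha : 6 ≤ a.val) : 6 ≤ (π a).val := by
  by_contra hlt
  push Not at hlt
  -- `π` maps the 6-set `H` into itself injectively, hence onto: `π a = π a'` for some `a' ∈ H`
  set H : Finset (Fin 12) := Finset.univ.filter fun x => x.val < 6 with hH
  have hmaps : Set.MapsTo π (H : Set (Fin 12)) (H : Set (Fin 12)) := fun x hx => by
    simp only [hH, Finset.coe_filter, Finset.mem_univ, true_and, Set.mem_setOf_eq] at hx ⊢
    exact lt_six_map hinj hadj hx
  have hsurj := Finset.surjOn_of_injOn_of_card_le π hmaps (hinj.injOn) le_rfl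
  have hπa : π a ∈ (H : Set (Fin 12)) := by
    simp only [hH, Finset.coe_filter, Finset.mem_univ, true_and, Set.mem_setOf_eq]; exact hlt
  obtain ⟨a', ha', he⟩ := hsurj hπa
  have : a' = a := hinj he
  simp only [hH, Finset.coe_filter, Finset.mem_univ, true_and, Set.mem_setOf_eq] at ha'
  omega

/-! ## §3 The hexagon part: a 6-cycle automorphism -/

/-- The induced map on the hexagon indices. [folklore] -/
def τ (m : Fin 6) : Fin 6 := ⟨(π (hx m)).val, lt_six_map hinj hadj (hx_lt m)⟩

/-- `hx ∘ τ = π ∘ hx`. [folklore] -/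
theorem hx_τ (m : Fin 6) : hx (τ hinj hadj m) = π (hx m) := Fin.ext rfl

/-- Iterates: `hx ∘ τⁿ = πⁿ ∘ hx`. [folklore] -/
theorem hx_τ_iterate (n : ℕ) (m : Fin 6) : hx ((τ hinj hadj)^[n] m) = π^[n] (hx m) := by
  induction n generalizing m with
  | zero => rfl
  | succ n ih => rw [Function.iterate_succ_apply, Function.iterate_succ_apply, ← hx_τ hinj hadj, ih]

/-- **`π⁶ = id` on the hexagon.** [folklore] -/
theorem pow_six_hx (m : Fin 6) : π^[6] (hx m) = hx m := by
  have hτinj : Function.Injective (τ hinj hadj) := fun m n h => by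
    have h' : π (hx m) = π (hx n) := by rw [← hx_τ hinj hadj, ← hx_τ hinj hadj, h]
    have := hinj h'
    exact Fin.ext (by have := congrArg Fin.val this; exact this)
  have hτadj : ∀ m n, cyc m n → cyc (τ hinj hadj m) (τ hinj hadj n) := fun m n h => by
    rw [← adj_hx_iff] at h ⊢
    rw [hx_τ, hx_τ]
    exact hadj _ _ h
  rw [← hx_τ_iterate hinj hadj, cyc_aut_pow_six hτinj hτadj]

/-! ## §4 The triangle part: `π (side, i) = (side ⊻ e, g i)` -/

/-- Image side and image pair of a triangle vertex. [folklore] -/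
theorem tv_map (s : Bool) (i : Fin 3) : π (tv s i) = tv (side (π (tv s i))) (pidx (π (tv s i))) :=
  (tv_side_pidx _ (six_le_map hinj hadj (six_le_tv s i))).symm

/-- **Partners go to a common pair**: `pidx (π tᵢ) = pidx (π bᵢ)` (both images are joined to `π h_{2i}, π h_{2i+1}`). [folklore] -/
theorem pidx_map_eq (i : Fin 3) : pidx (π (tv true i)) = pidx (π (tv false i)) := by
  set m : Fin 6 := ⟨2 * i.val, by omega⟩ with hm
  have ht : J.Adj (tv true i) (hx m) := (adj_tv_hx_iff true i m).2 (Or.inl rfl)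
  have hb : J.Adj (tv false i) (hx m) := (adj_tv_hx_iff false i m).2 (Or.inl rfl)
  have ht' := hadj _ _ ht
  have hb' := hadj _ _ hb
  rw [tv_map hinj hadj true i, ← hx_τ hinj hadj, adj_tv_hx_iff] at ht'
  rw [tv_map hinj hadj false i, ← hx_τ hinj hadj, adj_tv_hx_iff] at hb'
  apply Fin.ext
  omega

/-- **Partners go to different sides.** [folklore] -/
theorem side_map_ne (i : Fin 3) : side (π (tv true i)) ≠ side (π (tv false i)) := by
  intro h
  have e : π (tv true i) = π (tv false i) := by
    rw [tv_map hinj hadj true i, tv_map hinj hadj false i, h, pidx_map_eq hinj hadj i]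
  exact tv_true_ne_false i (hinj e)

/-- **Same-side vertices go to a common side.** [folklore] -/
theorem side_map_eq (s : Bool) (i j : Fin 3) : side (π (tv s i)) = side (π (tv s j)) := by
  by_cases hij : i = j
  · rw [hij]
  · have h := hadj _ _ ((adj_tv_iff s s i j).2 ⟨rfl, hij⟩)
    rw [tv_map hinj hadj s i, tv_map hinj hadj s j, adj_tv_iff] at h
    exact h.1

/-- The pair index of the image is `g` of the pair index, on both sides. [folklore] -/
theorem pidx_map (s : Bool) (i : Fin 3) : pidx (π (tv s i)) = g π i := by
  cases s
  · exact (pidx_map_eq hinj hadj i).symm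
  · rfl

/-- The side of the image: `side (π (tv s i)) = (s == e)` with `e := side (π t₀)`. [folklore] -/
theorem side_map (s : Bool) (i : Fin 3) : side (π (tv s i)) = (s == side (π (tv true 0))) := by
  cases s
  · have h1 := side_map_ne hinj hadj i
    have h2 := side_map_eq hinj hadj true i 0
    rw [h2] at h1
    revert h1
    cases side (π (tv false i)) <;> cases side (π (tv true 0)) <;> decide
  · rw [side_map_eq hinj hadj true i 0]; cases side (π (tv true 0)) <;> rfl

/-- `g` is injective. [folklore] -/
theorem g_injective : Function.Injective (g π) := by
  intro i j h
  have h1 := tv_map hinj hadj true i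
  have h2 := tv_map hinj hadj true j
  rw [pidx_map hinj hadj, side_map hinj hadj] at h1 h2
  have e : π (tv true i) = π (tv true j) := by rw [h1, h2, h]
  have := hinj e
  have := congrArg pidx this
  rwa [pidx_tv, pidx_tv] at this

/-- **Iterates on the triangles**: `πⁿ (tv s i) = tv (fⁿ s) (gⁿ i)` with `f s = (s == e)`. [folklore] -/
theorem tv_map_iterate (n : ℕ) (s : Bool) (i : Fin 3) :
    π^[n] (tv s i) = tv ((fun s => (s == side (π (tv true 0))))^[n] s) ((g π)^[n] i) := by
  induction n generalizing s i with
  | zero => rfl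
  | succ n ih =>
    rw [Function.iterate_succ_apply, Function.iterate_succ_apply, Function.iterate_succ_apply, tv_map hinj hadj s i, pidx_map hinj hadj,
      side_map hinj hadj, ih]

/-- **`π⁶ = id` on the triangles.** [folklore] -/
theorem pow_six_tv (s : Bool) (i : Fin 3) : π^[6] (tv s i) = tv s i := by
  rw [tv_map_iterate hinj hadj 6 s i, fin3_inj_pow_six _ (g_injective hinj hadj)]
  congr 1
  simp only [Function.iterate_succ, Function.iterate_zero, Function.comp_apply, id_eq, beq_beq]

/-! ## §5 The theorem -/

/-- **THEOREM: every injective adjacency-preserving self-map of the triangular orthobicupola graph satisfies `π⁶ = id`.**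
[cite: ConwaySloane1999, Ch. 4 §6.1] -/
theorem aut_pow_six (a : Fin 12) : π^[6] a = a := by
  by_cases ha : a.val < 6
  · have : a = hx ⟨a.val, ha⟩ := Fin.ext rfl
    rw [this]; exact pow_six_hx hinj hadj _
  · have h := tv_side_pidx a (by omega)
    rw [← h]; exact pow_six_tv hinj hadj _ _

end J27

end Summit.CriticalPhenomena.PercolationContinuityZ3.Theorems.Transplant
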